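import Summits.BirchSwinnertonDyer.BirchSwinnertonDyer.Theorems.PrintCf2RubinValueTwoFourTermMuDefect
import HarnessLib

/-!
# `μ_π(M) = 0` from a MAPPED characteristic-ideal identity `(char M)·R' = (G)` with `φ(π) ∤ G` — reading brick (c)'s output
# `(char (U_v/C̄)_χ)·𝒪 = (G_χ)` together with «`μ(G_χ) = 0`» as the `μ`-input of the S3a sockets

Cell `bsd-print-cf2`, width seat `bsd-line-cf2c-w6` g2 (AUTOFILL #2 PART 2 item (3)), brick §4(d) of the LEAD memo
`Cruxes/SplitBadTwoRankOneOfFacts/RULING-B23-g13.md` for crux `PrintCf2RubinValueTwo.TwoVariableMainConjAtSplitTwo(Quad)`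
(stmt-BirchSwinnertonDyer-23720 / 24033, S3a), part II (o). The sockets (`…OfCoinvariants`, `…PPrimary`, `…OfDualInvariants(OrderTwo)`)
take `μ_p = 0` POINTWISE on `U` or on its two `χ`-components; brick (c) delivers `(char U_χ).map φ = Ideal.span {G_χ}` along the
coefficient map `φ : Λ₂ → 𝒪⟦T₁,T₂⟧` (`φ = PowerSeries.map (PowerSeries.map J)`), and Oukhaba–Viguié's `μ = 0` is a statement about
`G_χ`: `φ(p) ∤ G_χ`. `…FourTermMuDefect.forall_exists_smul_eq_zero_of_charIdeal_eq_span_of_not_dvd` covers the UNMAPPED case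
`char M = (f)`; this file is the mapped form: for `M` finitely generated torsion over a Noetherian domain `R`, `π ∈ R` prime, a ring map
`φ : R → R'` and `G ∈ R'` with `(char M).map φ = (G)` and `¬ φ π ∣ G`, every element of `M` is killed by some `r ∉ (π)`
(`lengthAt ≠ 0 ⟹ char M ≤ (π) ⟹ (G) ≤ (φ π) ⟹ φ π ∣ G`). `Λ₂`, `π = p` reading at the end.

THEOREMS ONLY (no `def`, no named fact, no `sorry`); Theses-free; `--supports` the crux as a helper. BSD is not proved by any of this;
no summit statement is proved here.

References: Neukirch–Schmidt–Wingberg V §3 (5.3.9)–(5.3.10) [NeukirchSchmidtWingberg2008]; H. Oukhaba, S. Viguié, Forum Math. 28 (2016)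
[OukhabaViguie2016MuInvariant]; K. Rubin, Invent. Math. 103 (1991) §4 [Rubin1991].
-/

noncomputable section

set_option linter.dupNamespace false -- D-0017: single-problem summit, `…BirchSwinnertonDyer.BirchSwinnertonDyer…` repeats a namespace by design
set_option autoImplicit false

open scoped Classical

namespace Summit.BirchSwinnertonDyer.BirchSwinnertonDyer.Theorems.PrintCf2.FourTerm

open Literature.NumberTheory.EllipticCurves

universe u₁

variable {R : Type*} [CommRing R] {M : Type u₁} [AddCommGroup M] [Module R M]

/-- **`(char M)·R' = (G)` with `φ(π) ∤ G` ⟹ `μ_π(M) = 0`** (pointwise): for `M` finitely generated torsion over a Noetherian domain,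
`π` a prime element, `φ : R →+* R'` any ring map. If some element of `M` survived every `r ∉ (π)`, then `lengthAt_{(π)} M ≠ 0`, so
`char M ≤ (π)` (`charIdeal_le_of_lengthAt_ne_zero`), hence `(G) = (char M)·R' ≤ (φ π)` and `φ π ∣ G`.
[cite: NeukirchSchmidtWingberg2008, Ch. V §3, (5.3.9)–(5.3.10)] -/
theorem forall_exists_smul_eq_zero_of_map_charIdeal_eq_span_of_not_dvd [IsNoetherianRing R] [IsDomain R]
    [Module.Finite R M] (hM : Module.IsTorsion R M) {π : R} (hπ : Prime π) {R' : Type*} [CommRing R']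
    (φ : R →+* R') {G : R'} (hchar : (Module.charIdeal R M).map φ = Ideal.span {G}) (hG : ¬ φ π ∣ G) :
    ∀ m : M, ∃ r ∉ Ideal.span {π}, r • m = 0 := by
  haveI hprime : (Ideal.span {π}).IsPrime := (Ideal.span_singleton_prime hπ.ne_zero).mpr hπ
  refine forall_exists_smul_eq_zero_of_not_charIdeal_le hM ⟨Ideal.span {π}, hprime⟩
    (Module.height_span_singleton_eq_one_of_prime hπ) fun hle ↦ hG ?_
  have h := Ideal.map_mono (f := φ) hle
  rw [hchar, Ideal.map_span, Set.image_singleton, Ideal.span_singleton_le_iff_mem, Ideal.mem_span_singleton] at h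
  exact h

/-- **Over `Λ₂`**: `(char M).map φ = (G)` with `φ(p) ∤ G` ⟹ `μ_p(M) = 0` pointwise — the `μ`-input `hμU` / `hμ₁`, `hμχ` of the S3a
sockets from brick (c)'s mapped identity for `M = U_χ = SemilocalUnitData₂.Coinv χ` and «`μ(G_χ) = 0`» read as `φ(p) ∤ G_χ` in
`𝒪⟦T₁,T₂⟧`. [cite: OukhabaViguie2016MuInvariant, Thm. 1 (μ = 0 at p = 2, 3)] [cite: NeukirchSchmidtWingberg2008, Ch. V §3, (5.3.9)–(5.3.10)] -/
theorem forall_exists_smul_eq_zero_iwasawaAlgebra₂_of_map_charIdeal_eq_span_of_not_dvd {p : ℕ} [Fact p.Prime]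
    {M₂ : Type u₁} [AddCommGroup M₂] [Module (IwasawaAlgebra₂ p) M₂] [Module.Finite (IwasawaAlgebra₂ p) M₂]
    (hM : Module.IsTorsion (IwasawaAlgebra₂ p) M₂) {R' : Type*} [CommRing R'] (φ : IwasawaAlgebra₂ p →+* R') {G : R'}
    (hchar : (Module.charIdeal (IwasawaAlgebra₂ p) M₂).map φ = Ideal.span {G}) (hG : ¬ φ ((p : ℕ) : IwasawaAlgebra₂ p) ∣ G) :
    ∀ m : M₂, ∃ r ∉ Ideal.span {((p : ℕ) : IwasawaAlgebra₂ p)}, r • m = 0 :=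
  forall_exists_smul_eq_zero_of_map_charIdeal_eq_span_of_not_dvd hM prime_natCast_iwasawaAlgebra₂ φ hchar hG

end Summit.BirchSwinnertonDyer.BirchSwinnertonDyer.Theorems.PrintCf2.FourTerm

end
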